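import Summits.AtomisticToContinuum.HydrodynamicLimit.Theorems.CollisionIsometryCLTAdaptedWeightCLTTLStubDuhamel

/-!
# Column depolarisation, part A1: the PIECE REPRESENTATION of the incoherent transport
(helpers for the registered stub `stub_columnDepolarisation` of the line `contact-source-duhamel`,
crux `CollisionIsometryCLT.AdaptedWeightCLT`, stmt-AtomisticToContinuum-14868; `--supports`,
anchor `norm_sq_projV_add_coprojV`)

Exact algebra of the typed fold of `Theorems/CollisionIsometryCLTAdaptedWeightCLTLine.lean`, no
dynamics, no measure theory, true for every `σ`.

* `tStep_single_tpow`: one step of the incoherent transport `𝒯` splits an injected power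
  `δ_c m^{⊗r}` (`r ≥ 1`) into the two CHILD PIECES `δ_c (Q m)^{⊗r} + δ_{c'} (P m)^{⊗r}` at a step
  reflecting a pair containing `c` (partner `c'`, `P = projV n`, `Q = coprojV n`, `n` the step normal),
  and leaves it alone otherwise (`childCar`, `childVec`); the children's energies add up,
  `‖P m‖² + ‖Q m‖² = ‖m‖²` (`norm_sq_projV_add_coprojV`, `childVec_energy`).
* `tTransport_single_tpow`, `cloud_eq_sum_pieces`, `pieces_energy`: after `m` steps the transport of
  `δ_k a^{⊗r}` is the sum over the `2^m` words `w : Fin m → Bool` of `δ_{car w} (vec w)^{⊗r}` with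
  `Σ_w ‖vec w‖² = ‖a‖²` (the ENERGY IDENTITY `Σ_α |A_α a|² = |a|²` of the line's docstring); the pieces
  `pieceCar`, `pieceVec` do not depend on the rank `r`, so the rank-2 and rank-3 clouds of one impulse
  are the second and third moment tensors of ONE finite cloud of vectors (part A2 turns this into
  `0 ≤ cd2 ≤ 6`, `0 ≤ cd3x ≤ 78`).

The tensor-algebra and `tStep` bookkeeping lemmas (`mapT_add`, `mapT_tpow`, `projM_mulVec`,
`coprojM_mulVec`, `mapT_projM_tpow`, `mapT_coprojM_tpow`, `stepPair_fst_lt_snd`, `tStep_of_none/some`,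
`tStep_add/zero/sum`, `tTransport_zero/succ`) are those of the rev-12 home of `stub_duhamel`,
`Theorems/CollisionIsometryCLTAdaptedWeightCLTTLStubDuhamel.lean` (namespace `…TimeLocal.Duhamel`,
imported and opened here); only `mapT_zero`, `tpow_zero_vec`, `sum_sq_eq_norm_sq` and the energy
identity `norm_sq_projV_add_coprojV` are new in the first section.
-/

namespace Summit.AtomisticToContinuum.HydrodynamicLimit.Theorems.ContactSourceDuhamel.TimeLocal
namespace ColumnDepolarisation

open scoped BigOperators Topology Classical MeasureTheory ENNReal InnerProductSpace
open Filter Set MeasureTheory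
open Literature.Analysis.FluidPDE
open Literature.MathematicalPhysics.KineticTheory (hsDiameter)
open Duhamel

noncomputable section

variable {σ : ℝ} {N : ℕ} {y : Cfg N} {r : ℕ}

/-! ## Two more tensor-algebra facts (the rest is `…TimeLocal.Duhamel`, opened above) -/

/-- `mapT M 0 = 0`. -/
theorem mapT_zero (M : Mat3) : mapT M (0 : Tens r) = 0 := by
  funext idx
  simp [mapT]

/-! ## The zero power and the energy of a split -/

/-- `0^{⊗r} = 0` for `r ≥ 1`. -/
theorem tpow_zero_vec (hr : 0 < r) : tpow r (0 : V3) = 0 := by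
  funext idx
  simp only [tpow, Pi.zero_apply]
  exact Finset.prod_eq_zero (Finset.mem_univ (⟨0, hr⟩ : Fin r)) (by simp)

/-- `Σ_b m_b² = ‖m‖²` on `ℝ³`. -/
theorem sum_sq_eq_norm_sq (m : V3) : ∑ b, (m b) ^ 2 = ‖m‖ ^ 2 :=
  (EuclideanSpace.real_norm_sq_eq m).symm

/-- The energy of a split: `‖P a‖² + ‖Q a‖² = ‖a‖²` (Pythagoras; at `n = 0`, `P = 0`, `Q = id`). -/
theorem norm_sq_projV_add_coprojV :
    ∀ n a : V3, ‖projV n a‖ ^ 2 + ‖coprojV n a‖ ^ 2 = ‖a‖ ^ 2 := by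
  intro n a
  have hsplit : a = projV n a + coprojV n a := by simp [coprojV]
  have key : ⟪projV n a, coprojV n a⟫_ℝ = 0 := by
    by_cases hn : n = 0
    · subst hn
      simp [projV]
    · have hn' : ‖n‖ ≠ 0 := norm_ne_zero_iff.2 hn
      have hc : coprojV n a = a - projV n a := rfl
      rw [hc, inner_sub_right]
      simp only [projV, real_inner_smul_left, real_inner_self_eq_norm_sq, norm_smul, mul_pow,
        Real.norm_eq_abs, sq_abs]
      field_simp
      ring
  conv_rhs => rw [hsplit]
  rw [norm_add_sq_real, key]
  ring

/-! ## Pieces: one step of the incoherent transport on an injected power -/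

/-- The CARRIER of the child `b` (`false`: the piece that stays, `true`: the piece handed over) of a
piece sitting at carrier `c` when fold step `k` is applied. -/
def childCar (σ : ℝ) (N : ℕ) (y : Cfg N) (k : ℕ) (c : Fin (N + 1)) (b : Bool) : Fin (N + 1) :=
  match stepPair σ N y k with
  | none => c
  | some pq => if b then (if c = pq.1 then pq.2 else if c = pq.2 then pq.1 else c) else c

/-- The VECTOR of the child `b` of a piece `m` sitting at carrier `c` when fold step `k` is applied:
`Q m` stays and `P m` is handed to the partner if `c` is reflected; otherwise `m` stays and the
handed-over child is the zero vector. -/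
def childVec (σ : ℝ) (N : ℕ) (y : Cfg N) (k : ℕ) (c : Fin (N + 1)) (m : V3) (b : Bool) : V3 :=
  match stepPair σ N y k with
  | none => if b then 0 else m
  | some pq =>
    if c = pq.1 ∨ c = pq.2 then
      (if b then projV (stepNormal σ N y k) m else coprojV (stepNormal σ N y k) m)
    else (if b then 0 else m)

/-- The children's energies add up to the parent's. -/
theorem childVec_energy (k : ℕ) (c : Fin (N + 1)) (m : V3) :
    ∑ b : Bool, ‖childVec σ N y k c m b‖ ^ 2 = ‖m‖ ^ 2 := by
  rw [Fintype.sum_bool]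
  rcases h : stepPair σ N y k with _ | ⟨p, q⟩
  · simp [childVec, h]
  · by_cases hc : c = p ∨ c = q
    · simp only [childVec, h, if_pos hc, if_true]
      simpa using norm_sq_projV_add_coprojV (stepNormal σ N y k) m
    · simp [childVec, h, if_neg hc]

/-- ONE STEP of `𝒯` on an injected power (`r ≥ 1`): the piece `δ_c m^{⊗r}` becomes the sum of its
two children `δ_{car b} (vec b)^{⊗r}`. -/
theorem tStep_single_tpow (hr : 0 < r) (k : ℕ) (c : Fin (N + 1)) (m : V3) :
    tStep r σ N y k (Pi.single c (tpow r m)) =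
      ∑ b : Bool, Pi.single (childCar σ N y k c b) (tpow r (childVec σ N y k c m b)) := by
  rw [Fintype.sum_bool]
  rcases h : stepPair σ N y k with _ | ⟨p, q⟩
  · rw [tStep_of_none h]
    simp [childCar, childVec, h, tpow_zero_vec hr]
  · have hpq : p ≠ q := ne_of_lt (stepPair_fst_lt_snd h)
    rw [tStep_of_some h]
    by_cases hcp : c = p
    · subst hcp
      have hTq : (Pi.single c (tpow r m) : Fin (N + 1) → Tens r) q = 0 :=
        Pi.single_eq_of_ne (Ne.symm hpq) _
      simp only [Pi.single_eq_same, hTq, mapT_zero, add_zero, zero_add, mapT_coprojM_tpow,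
        mapT_projM_tpow, childCar, childVec, h, if_true, true_or]
      funext i
      by_cases hiq : i = q
      · subst hiq
        simp [Function.update_self, Ne.symm hpq]
      · rw [Function.update_of_ne hiq]
        by_cases hic : i = c
        · subst hic
          simp [hpq]
        · rw [Function.update_of_ne hic]
          simp [hic, hiq]
    · by_cases hcq : c = q
      · subst hcq
        have hTp : (Pi.single c (tpow r m) : Fin (N + 1) → Tens r) p = 0 :=
          Pi.single_eq_of_ne hpq _
        simp only [Pi.single_eq_same, hTp, mapT_zero, add_zero, zero_add, mapT_coprojM_tpow,
          mapT_projM_tpow, childCar, childVec, h, if_true, or_true, if_neg hcp]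
        funext i
        by_cases hic : i = c
        · subst hic
          simp [Function.update_self, hpq]
        · rw [Function.update_of_ne hic]
          by_cases hip : i = p
          · subst hip
            simp [Ne.symm hpq]
          · rw [Function.update_of_ne hip]
            simp [hic, hip]
      · have hTp : (Pi.single c (tpow r m) : Fin (N + 1) → Tens r) p = 0 :=
          Pi.single_eq_of_ne (Ne.symm hcp) _
        have hTq : (Pi.single c (tpow r m) : Fin (N + 1) → Tens r) q = 0 :=
          Pi.single_eq_of_ne (Ne.symm hcq) _
        have hco : ¬ (c = p ∨ c = q) := not_or.2 ⟨hcp, hcq⟩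
        simp only [hTp, hTq, mapT_zero, add_zero, childCar, childVec, h, if_neg hco, if_neg hcp,
          if_neg hcq, if_true, tpow_zero_vec hr, Pi.single_zero, zero_add]
        have e1 : Function.update (Pi.single c (tpow r m) : Fin (N + 1) → Tens r) p 0 =
            Pi.single c (tpow r m) := Function.update_eq_self_iff.2 hTp.symm
        have e2 : Function.update (Pi.single c (tpow r m) : Fin (N + 1) → Tens r) q 0 =
            Pi.single c (tpow r m) := Function.update_eq_self_iff.2 hTq.symm
        rw [e1, e2]
        simp

/-! ## Pieces after `m` steps -/

/-- The carrier of the piece with history `w : Fin m → Bool` of an impulse injected at `k`, after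
the first `m` fold steps. -/
def pieceCar (σ : ℝ) (N : ℕ) (y : Cfg N) (k : Fin (N + 1)) : (m : ℕ) → (Fin m → Bool) → Fin (N + 1)
  | 0, _ => k
  | m + 1, w => childCar σ N y m (pieceCar σ N y k m (Fin.init w)) (w (Fin.last m))

/-- The vector of the piece with history `w` of the impulse `a` injected at `k`, after `m` steps
(a product of `m` projections `P`/`Q`/`id`/`0` applied to `a`; independent of the rank). -/
def pieceVec (σ : ℝ) (N : ℕ) (y : Cfg N) (k : Fin (N + 1)) (a : V3) :
    (m : ℕ) → (Fin m → Bool) → V3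
  | 0, _ => a
  | m + 1, w => childVec σ N y m (pieceCar σ N y k m (Fin.init w))
      (pieceVec σ N y k a m (Fin.init w)) (w (Fin.last m))

/-- THE PIECE REPRESENTATION (`r ≥ 1`): `𝒯_{0→m}(δ_k a^{⊗r}) = Σ_w δ_{car w} (vec w)^{⊗r}`. -/
theorem tTransport_single_tpow (hr : 0 < r) (k : Fin (N + 1)) (a : V3) (m : ℕ) :
    tTransport r σ N y 0 m (Pi.single k (tpow r a)) =
      ∑ w : Fin m → Bool, Pi.single (pieceCar σ N y k m w) (tpow r (pieceVec σ N y k a m w)) := by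
  induction m with
  | zero =>
      rw [tTransport_zero, Fintype.sum_unique]
      rfl
  | succ m ih =>
      rw [tTransport_succ, zero_add, ih, tStep_sum]
      simp_rw [tStep_single_tpow hr]
      rw [← Fintype.sum_equiv (Fin.snocEquiv fun _ => Bool)
        (fun bw => Pi.single (pieceCar σ N y k (m + 1) (Fin.snocEquiv (fun _ => Bool) bw))
          (tpow r (pieceVec σ N y k a (m + 1) (Fin.snocEquiv (fun _ => Bool) bw))))
        _ (fun _ => rfl), Fintype.sum_prod_type, Finset.sum_comm]
      refine Finset.sum_congr rfl fun w _ => Finset.sum_congr rfl fun b _ => ?_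
      simp [pieceCar, pieceVec, Fin.snocEquiv]

/-- The ENERGY IDENTITY of the pieces: `Σ_w ‖vec w‖² = ‖a‖²`. -/
theorem pieces_energy (k : Fin (N + 1)) (a : V3) (m : ℕ) :
    ∑ w : Fin m → Bool, ‖pieceVec σ N y k a m w‖ ^ 2 = ‖a‖ ^ 2 := by
  induction m with
  | zero =>
      rw [Fintype.sum_unique]
      rfl
  | succ m ih =>
      rw [← Fintype.sum_equiv (Fin.snocEquiv fun _ => Bool)
        (fun bw => ‖pieceVec σ N y k a (m + 1) (Fin.snocEquiv (fun _ => Bool) bw)‖ ^ 2)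
        _ (fun _ => rfl), Fintype.sum_prod_type, Finset.sum_comm, ← ih]
      refine Finset.sum_congr rfl fun w _ => ?_
      have := childVec_energy (σ := σ) (y := y) m (pieceCar σ N y k m w) (pieceVec σ N y k a m w)
      simpa [pieceVec, Fin.snocEquiv] using this

/-- The CLOUD as a sum of powers of the pieces: `cloud r = Σ_w (vec w)^{⊗r}` (`r ≥ 1`). -/
theorem cloud_eq_sum_pieces (hr : 0 < r) (m : ℕ) (k : Fin (N + 1)) (a : V3) :
    cloud r σ N y m k a = ∑ w : Fin m → Bool, tpow r (pieceVec σ N y k a m w) := by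
  unfold cloud
  rw [tTransport_single_tpow hr]
  simp only [Finset.sum_apply]
  rw [Finset.sum_comm]
  refine Finset.sum_congr rfl fun w _ => ?_
  exact Fintype.sum_pi_single' _ _

/-- Every piece is at most as long as the impulse. -/
theorem norm_pieceVec_le (k : Fin (N + 1)) (a : V3) (m : ℕ) (w : Fin m → Bool) :
    ‖pieceVec σ N y k a m w‖ ≤ ‖a‖ := by
  have h : ‖pieceVec σ N y k a m w‖ ^ 2 ≤ ‖a‖ ^ 2 := by
    rw [← pieces_energy (σ := σ) (y := y) k a m]
    exact Finset.single_le_sum (f := fun w => ‖pieceVec σ N y k a m w‖ ^ 2)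
      (fun _ _ => sq_nonneg _) (Finset.mem_univ w)
  exact (pow_le_pow_iff_left₀ (norm_nonneg _) (norm_nonneg _) two_ne_zero).1 h

end

end ColumnDepolarisation
end Summit.AtomisticToContinuum.HydrodynamicLimit.Theorems.ContactSourceDuhamel.TimeLocal
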